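import Literature.NumberTheory.EllipticCurves.CuspFormLFunction
import Literature.NumberTheory.DiophantineGeometry.Conductor

/-!
# H1 vacuity probe (bsd-idea-19 g42, lens dual) — kernel-checked sanity items

Scope: the hypothesis `exists_isNewformOf` (H1) of the conditional closer
`ManinLocalTwoThree.StevensCurve.maninConstantOne_of_threePrintedFacts` and of crux C5
`ManinLocalTwoThree.ManinPrimeToAdditiveFiveLe` (stmt-BirchSwinnertonDyer-22969).
This file records only the cheap kernel-checkable consistency items of the memo
`Cruxes/ManinPrimeToAdditiveFiveLe/Lines/h1-vacuity-probe-dual.md`; the substantive audit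
(Tate's algorithm steps 1–10 vs Silverman ATAEC IV.9.4, Ogg's formula, Mathlib `minimal`,
`eulerProduct` junk analysis) is by inspection and lives in the memo. Nothing here is proposed.
-/

open scoped MatrixGroups ModularForm
open CongruenceSubgroup

namespace H21Probe.BsdIdea19.H1Vacuity

open Literature.NumberTheory.DiophantineGeometry

/-! ## (a) `n = 0`: both sides of `cuspCoeff f n = W.LFunction n` vanish at `n = 0`
(`W.LFunction` is an `ArithmeticFunction ℤ`). -/
example (W : WeierstrassCurve ℚ) : W.LFunction 0 = 0 := by simp

/-! ## (b) Ogg's formula `f = ord(Δ_min) + 1 − m` is literally the tree definition. -/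
example {A : Type*} [CommRing A] [IsDedekindDomain A] {K : Type*} [Field K] [Algebra A K]
    [IsFractionRing A K] (v : IsDedekindDomain.HeightOneSpectrum A) (W : WeierstrassCurve K) :
    W.conductorExponent v = W.ordMinimalDiscriminant v + 1 - W.numComponentsAt v := rfl

/-! ## (c) The component table `m` (ATAEC Table 4.1 / step text of IV.9.4) combined with Néron's
`ord Δ` values in residue characteristic `≥ 5` gives `f = 0, 1, 2, 2, …, 2` — i.e. the tree's
`numComponents` table is the one Ogg's formula needs (no off-by-one in any constructor). -/
example : 0 + 1 - (KodairaSymbol.I 0).numComponents = 0 := by decide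
example (n : ℕ) : (n + 1) + 1 - (KodairaSymbol.I (n + 1)).numComponents = 1 := by
  simp only [KodairaSymbol.numComponents_I_succ]; omega
example : 2 + 1 - KodairaSymbol.II.numComponents = 2 := by decide
example : 3 + 1 - KodairaSymbol.III.numComponents = 2 := by decide
example : 4 + 1 - KodairaSymbol.IV.numComponents = 2 := by decide
example : 6 + 1 - (KodairaSymbol.Istar 0).numComponents = 2 := by decide
example (n : ℕ) : (n + 6) + 1 - (KodairaSymbol.Istar n).numComponents = 2 := by
  simp only [KodairaSymbol.numComponents_Istar]; omega
example : 8 + 1 - KodairaSymbol.IVstar.numComponents = 2 := by decide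
example : 9 + 1 - KodairaSymbol.IIIstar.numComponents = 2 := by decide
example : 10 + 1 - KodairaSymbol.IIstar.numComponents = 2 := by decide

/-! ## (d) Silverman's per-step conductor values for arbitrary residue characteristic
(IV.9.4: `I_n*: f = v(Δ) − 4 − n`, `IV*: f = v(Δ) − 6`, `III*: f = v(Δ) − 7`, `II*: f = v(Δ) − 8`)
agree with Ogg + the tree table, as identities in `ℕ` under the Ogg–Saito bound `m ≤ v(Δ) + 1`. -/
example (v n : ℕ) : v + 1 - (KodairaSymbol.Istar n).numComponents = v - 4 - n := by
  simp only [KodairaSymbol.numComponents_Istar]; omega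
example (v : ℕ) : v + 1 - KodairaSymbol.IVstar.numComponents = v - 6 := by
  show v + 1 - 7 = v - 6; omega
example (v : ℕ) : v + 1 - KodairaSymbol.IIIstar.numComponents = v - 7 := by
  show v + 1 - 8 = v - 7; omega
example (v : ℕ) : v + 1 - KodairaSymbol.IIstar.numComponents = v - 8 := by
  show v + 1 - 9 = v - 8; omega

/-! ## (e) `IsNormalized` is `a₁ = 1`, consistent with `W.LFunction 1 = 1` being forced by
`cuspCoeff f 1 = W.LFunction 1` only if the Euler product has value `1` at `1`; we record the
definitional unfolding used in the memo. -/
example {N : ℕ} (f : CuspForm (Gamma0 N) 2) :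
    Literature.NumberTheory.EllipticCurves.ModularForms.IsNormalized f ↔
      Literature.NumberTheory.EllipticCurves.ModularForms.cuspCoeff f 1 = 1 := Iff.rfl

end H21Probe.BsdIdea19.H1Vacuity
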